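import Literature.NumberTheory.EllipticCurves.BSDQuadraticDescent
import Literature.NumberTheory.EllipticCurves.IsogenyMordellWeilRankProofs
import Literature.NumberTheory.EllipticCurves.RegulatorBasisProofs
import Literature.NumberTheory.EllipticCurves.RegulatorProofs
import Literature.NumberTheory.EllipticCurves.MordellWeilTheoremProofs
import Literature.NumberTheory.EllipticCurves.ShaIsogenyProofs
import Mathlib.LinearAlgebra.FreeModule.Finite.CardQuotient
import Mathlib.GroupTheory.FiniteAbelian.Basic
import HarnessLib

/-!
# Cassels' isogeny invariance of the BSD quotient: Milne's bookkeeping (proofs towards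
# `WeierstrassCurve.bsdRHS_eq_of_isIsogenous`)

Sibling *proofs* file (theorems only, no definitions, no named facts) of
`Literature.NumberTheory.EllipticCurves.BSDQuadraticDescent` for its named fact
`WeierstrassCurve.bsdRHS_eq_of_isIsogenous` — **the Birch–Swinnerton-Dyer quotient
`#Ш · Reg · Ω · ∏ c_p / #E(ℚ)_tors²` is an isogeny invariant** (Cassels, J. reine angew. Math. 217
(1965); Milne, *Arithmetic Duality Theorems*, 2nd ed., Thm. I.7.3 with Remark 7.4, pp. 97–100).

Milne's proof (pp. 97–100) compares the conjectured formulas for `A` and `B` along an isogeny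
`f : A → B` with dual `f^t`, term by term, through the quantity `z(h) = [Ker h]/[Coker h]`
(Lemma 7.2): four "boxed formulas" — the height term `det⟨a'ⱼ, aᵢ⟩ = det⟨b'ⱼ, bᵢ⟩` with
`z(f(K)) = (A(K) : Σℤaᵢ)/(B(K) : Σℤbᵢ)`, `z(f^t(K)) = (B^t(K) : Σℤb'ᵢ)/(A^t(K) : Σℤa'ᵢ)`; the
`Ш` term `[Ш(A)]/[Ш(B)] = [Ker Ш(f)]/[Ker Ш(f^t)]` (Cassels–Tate pairing); the local term
`z(f(K_v)) = μ_v(A, ω_A)/μ_v(B, ω_B)` — reduce the theorem to the key identity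
(7.3.1) `∏_{v ∈ S} z(f(K_v)) = ([Ker Ш(f^t)]/[Ker Ш(f)]) · (z(f(K))/z(f^t(K)))`, which is then proved
from Tate local duality, the Poitou–Tate sequence (Thm. I.4.10) and the global Euler
characteristic formula (Thm. I.5.1).

This file **proves the bookkeeping** of that proof for elliptic curves over a number field, in the
tree's normalisations (`E ≅ E^t`, `Reg = det⟨Pᵢ, Pⱼ⟩` on a Mordell–Weil basis,
`#E(K)_tors² = [A(K)_tors][A^t(K)_tors]`), and isolates as explicit hypotheses the three inputs the
tree does not have: (H) the adjointness of `φ(K)` and `φ̂(K)` for the Néron–Tate pairings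
("functoriality of the height pairings"), (Ш) the Cassels–Tate relation
`#Ш(E) · #ker Ш(φ̂) = #Ш(E') · #ker Ш(φ)`, and (7.3.1) with its local side evaluated.

## Main statements

* `Literature.NumberTheory.EllipticCurves.card_ker_mul_card_eq_index_range_mul_card` — Lemma 7.2(a):
  `#ker f · #Y = #coker f · #X` for `f : X → Y` between finite abelian groups;
  `card_ker_mul_card_torsion_eq` (the same for the torsion parts),
  `index_range_eq_relIndex_mul_index_range_map` (`#coker f = #coker f_tors · #coker f̄` when
  `f⁻¹(tors) = tors`, the instance of Lemma 7.2(d) used on p. 97), and the resulting identity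
  `card_ker_mul_index_mul_card_torsion_sq_mul_index_eq`:
  `z(f)/z(g) = (#T_A/#T_B)² · [A/T_A : ḡ(B/T_B)]/[B/T_B : f̄(A/T_A)]`.
* `Literature.NumberTheory.EllipticCurves.transpose_toMatrix_mul_gram_eq`,
  `det_toMatrix_mul_det_gram_eq`, `index_range_eq_natAbs_det`, `index_mul_det_gram_eq` — the linear
  algebra of the height term: adjoint maps have transposed matrices for the Gram matrices, hence
  `[Λ' : u(Λ)] · det Gram' = det Gram · [Λ : v(Λ')]` (with Mathlib's
  `AddSubgroup.index_eq_natAbs_det`).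
* `WeierstrassCurve.index_mul_regulator_eq_regulator_mul_index` — **the regulator term** for
  elliptic curves over a number field: `[E'(K)/tors : f̄(E(K)/tors)] · Reg(E') =
  Reg(E) · [E(K)/tors : ḡ(E'(K)/tors)]` for `f`, `g` adjoint for the height pairings.
* `WeierstrassCurve.Isogeny.card_sha_mul_regulator_mul_eq_of_keyIdentity` — **Milne's Thm. I.7.3
  for elliptic curves over a number field modulo (H), (Ш), (7.3.1)**:
  `#Ш(E') · Reg(E') · x' · #E(K)_tors² = #Ш(E) · Reg(E) · x · #E'(K)_tors²` whenever the real
  numbers `x, x'` satisfy (7.3.1) in the form `x/x' = ([Ker Ш(φ̂)]/[Ker Ш(φ)]) · z(φ(K))/z(φ̂(K))`.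
* `WeierstrassCurve.bsdRHS_eq_of_keyIdentity` — over `ℚ`, with `x = Ω(E) ∏ c_p(E)`:
  `W'.bsdRHS = W.bsdRHS`, i.e. the conclusion of `bsdRHS_eq_of_isIsogenous` for the pair, from
  (H), (Ш), (7.3.1).

## What is *not* here (the remaining inputs of `bsdRHS_eq_of_isIsogenous_holds`)

(H) `⟨φP, Q⟩_{E'} = ⟨P, φ̂Q⟩_E` (from `ĥ_{E'}(φP) = deg φ · ĥ_E(P)`); (Ш) the Cassels–Tate pairing,
its non-degeneracy modulo divisibles and the adjointness of `Ш(φ)`, `Ш(φ̂)` (*ADT* I.6.13(a),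
proof of 7.3 p. 98; the tree has only the existential fact
`WeierstrassCurve.exists_casselsTate_pairing`); (7.3.1) itself (*ADT* pp. 99–100: Tate local
duality I.3.4/3.7, Poitou–Tate I.4.10, Euler characteristic I.5.2a) and the local volume
computations `z(φ(ℚ_p)) = |α|_p c_p(E)/c_p(E')`, `z(φ(ℝ)) = |α|_∞ Ω(E)/Ω(E')` for minimal models.
They enter the theorems below as explicit hypotheses on the given pair `(φ, φ̂)`; no statement of
the tree is restated and no named fact is introduced (D-0026).

## References

* J. S. Milne, *Arithmetic Duality Theorems*, 2nd ed. (2006), Ch. I §7: Lemma 7.2 (p. 96),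
  Thm. 7.3 and its proof (pp. 97–100), formula (7.3.1) (p. 98), Remark 7.4 (p. 100).
  [MilneADT2006]
* J. W. S. Cassels, *Arithmetic on curves of genus 1. VIII: On the conjectures of Birch and
  Swinnerton-Dyer*, J. reine angew. Math. 217 (1965), 180–199. [Cassels1965ArithmeticVIII]
* J. H. Silverman, *The Arithmetic of Elliptic Curves*, 2nd ed. (2009), III.6.1–6.2 (dual
  isogeny), VIII.9 (canonical height, regulator). [SilvermanAEC2009]

## Design notes

* Theorems only (kernel-reviewed sibling). General group-theoretic and lattice lemmas live in
  `namespace Literature.NumberTheory.EllipticCurves` (path namespace); the curve-level theorems are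
  deliberate dot-notation extensions in `namespace WeierstrassCurve` / `WeierstrassCurve.Isogeny`,
  as in the rest of the topic.
* The maps on rational points induced by an isogeny are not named in the tree
  (`WeierstrassCurve.Isogeny.exists_pointHom` is existential); they enter as data `f`, `g` with
  their characterising property `E(K) ↪ E(K̄)`-compatibility (`hf`, `hg`), exactly as in
  `IsogenyMordellWeilRankProofs.lean`. The dual isogeny enters as `ψ` with `ψ ∘ φ = [m]`, `m ≠ 0`
  (`Isogeny.exists_dual_of_isElliptic` provides it with `m = deg φ`).
* `DecidableEq ℚ`: the group law on `E(ℚ) = W.toAffine.Point` written over `ℚ` elaborates against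
  `instDecidableEqRat`, whereas the general-field theorems carry the classical instance
  (`open scoped Classical`); the `ℚ`-statement is therefore polymorphic in the instance
  (`[DecidableEq ℚ]`) and its proof substitutes the classical one (a subsingleton), as in
  `KramerDescentSelmerTwoSpanProofs.lean` / `IwasawaLeadingTermProofs.lean`.
* `noncomputable section`, `open scoped Classical`, as in the files of the topic.
-/

noncomputable section

open scoped Classical

open Module AddSubgroup

universe u

/-! ## Lemma 7.2: the index calculus `z(f) = #ker f / #coker f` -/

namespace Literature.NumberTheory.EllipticCurves

section IndexCalculus

variable {A B : Type*} [AddCommGroup A] [AddCommGroup B]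

/-- **Milne, *ADT*, Lemma I.7.2(a)**: for a homomorphism `f : X → Y` of finite abelian groups,
`z(f) = [Ker f]/[Coker f]` equals `[X]/[Y]`; in product form `#ker f · #Y = [Y : f(X)] · #X`
(`#coker f = [Y : f(X)]`, Mathlib `AddSubgroup.index`). [cite: MilneADT2006, Ch. I Lemma 7.2(a), p. 96] -/
theorem card_ker_mul_card_eq_index_range_mul_card (f : A →+ B) [Finite A] [Finite B] :
    Nat.card f.ker * Nat.card B = f.range.index * Nat.card A := by
  rw [← f.range.index_mul_card, ← f.ker.card_mul_index, AddSubgroup.index_ker]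
  ring

variable (f : A →+ B)

-- A homomorphism maps torsion into torsion (`A_tors ≤ f⁻¹(B_tors)`): this is Mathlib's
-- `AddCommGroup.le_comap_torsion`, used directly below.

variable {m : ℕ}

/-- If `g ∘ f = [m]` with `m ≠ 0` then `ker f` consists of torsion elements (as for an isogeny
and its dual, Silverman, *AEC*, III.6.2 / III.4.9). [folklore] -/
theorem ker_le_torsion_of_comp_eq_nsmul (g : B →+ A) (hm : m ≠ 0) (hgf : ∀ a, g (f a) = m • a) :
    f.ker ≤ AddCommGroup.torsion A := fun a ha ↦ by
  rw [AddCommGroup.mem_torsion, isOfFinAddOrder_iff_nsmul_eq_zero]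
  refine ⟨m, Nat.pos_of_ne_zero hm, ?_⟩
  rw [← hgf a, (AddMonoidHom.mem_ker).mp ha, map_zero]

/-- If `g ∘ f = [m]` with `m ≠ 0` then `f⁻¹(B_tors) = A_tors`. [folklore] -/
theorem comap_torsion_eq_of_comp_eq_nsmul (g : B →+ A) (hm : m ≠ 0) (hgf : ∀ a, g (f a) = m • a) :
    (AddCommGroup.torsion B).comap f = AddCommGroup.torsion A := by
  refine le_antisymm (fun a ha ↦ ?_) (AddCommGroup.le_comap_torsion f)
  rw [AddSubgroup.mem_comap, AddCommGroup.mem_torsion, isOfFinAddOrder_iff_nsmul_eq_zero] at ha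
  obtain ⟨n, hn, hna⟩ := ha
  rw [AddCommGroup.mem_torsion, isOfFinAddOrder_iff_nsmul_eq_zero]
  refine ⟨m * n, Nat.mul_pos (Nat.pos_of_ne_zero hm) hn, ?_⟩
  rw [mul_comm, mul_nsmul, ← hgf, map_nsmul, hna, map_zero]

/-- **Milne's Lemma I.7.2(a) for the torsion parts.** If `ker f ⊆ A_tors` and the torsion subgroups
are finite, then `#ker f · #B_tors = [B_tors : f(A_tors)] · #A_tors` (Lemma 7.2(a) applied to the
restriction `f_tors : A_tors → B_tors`, whose kernel is `ker f`).
[cite: MilneADT2006, Ch. I Lemma 7.2(a), p. 96] -/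
theorem card_ker_mul_card_torsion_eq (hk : f.ker ≤ AddCommGroup.torsion A)
    [Finite (AddCommGroup.torsion A)] [Finite (AddCommGroup.torsion B)] :
    Nat.card f.ker * Nat.card (AddCommGroup.torsion B) =
      ((AddCommGroup.torsion A).map f).relIndex (AddCommGroup.torsion B) *
        Nat.card (AddCommGroup.torsion A) := by
  -- the restriction `f_tors : A_tors → B_tors`
  let fT : AddCommGroup.torsion A →+ AddCommGroup.torsion B :=
    (f.comp (AddCommGroup.torsion A).subtype).codRestrict (AddCommGroup.torsion B)
      fun a ↦ AddCommGroup.le_comap_torsion f a.2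
  have hfT : ∀ a : AddCommGroup.torsion A, (fT a : B) = f a := fun a ↦ rfl
  have h := card_ker_mul_card_eq_index_range_mul_card fT
  -- `ker f_tors ≃ ker f`
  have hker : Nat.card fT.ker = Nat.card f.ker := by
    refine Nat.card_congr
      { toFun := fun a ↦ ⟨(a.1 : A), ?_⟩
        invFun := fun a ↦ ⟨⟨a.1, hk a.2⟩, ?_⟩
        left_inv := fun a ↦ by ext; rfl
        right_inv := fun a ↦ by ext; rfl }
    · have ha := a.2
      rw [AddMonoidHom.mem_ker] at ha ⊢
      rw [← hfT, ha, AddSubgroup.coe_zero]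
    · have ha := a.2
      rw [AddMonoidHom.mem_ker] at ha ⊢
      exact Subtype.ext (by rw [hfT]; exact ha)
  -- `f_tors(A_tors) = f(A_tors)` inside `B_tors`
  have hrange : fT.range = ((AddCommGroup.torsion A).map f).addSubgroupOf
      (AddCommGroup.torsion B) := by
    ext b
    simp only [AddMonoidHom.mem_range, AddSubgroup.mem_addSubgroupOf, AddSubgroup.mem_map]
    constructor
    · rintro ⟨a, rfl⟩
      exact ⟨a, a.2, rfl⟩
    · rintro ⟨a, ha, hab⟩
      exact ⟨⟨a, ha⟩, Subtype.ext hab⟩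
  rw [hker, hrange] at h
  exact h

/-- **The cokernel of `f : A → B` splits along the torsion subgroups**: with `T_A = A_tors`,
`T_B = B_tors` and `f⁻¹(T_B) = T_A` (e.g. `g ∘ f = [m]`, `m ≠ 0`),
`[B : f(A)] = [T_B : f(T_A)] · [B/T_B : f̄(A/T_A)]`, `f̄` the induced map on the torsion-free
quotients — the kernel–cokernel bookkeeping of Milne, *ADT*, Lemma I.7.2(d) for the map of
extensions `0 → T_A → A → A/T_A → 0`, `0 → T_B → B → B/T_B → 0`, whose third component is
injective (used on p. 97 with `Σℤaᵢ` in place of a complement of `T_A`).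
[cite: MilneADT2006, Ch. I Lemma 7.2(d), p. 96] -/
theorem index_range_eq_relIndex_mul_index_range_map
    (h : (AddCommGroup.torsion B).comap f = AddCommGroup.torsion A) :
    f.range.index =
      ((AddCommGroup.torsion A).map f).relIndex (AddCommGroup.torsion B) *
        (QuotientAddGroup.map (AddCommGroup.torsion A) (AddCommGroup.torsion B) f
          h.ge).range.index := by
  -- `[B : f(A)] = [f(A) ⊔ T_B : f(A)] · [B : f(A) ⊔ T_B]`
  rw [← AddSubgroup.relIndex_mul_index
    (le_sup_left : f.range ≤ f.range ⊔ AddCommGroup.torsion B)]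
  congr 1
  · -- `[f(A) ⊔ T_B : f(A)] = [T_B : f(A) ⊓ T_B]` and `f(A) ⊓ T_B = f(T_A)`
    rw [AddSubgroup.relIndex_sup_left, ← AddSubgroup.inf_relIndex_right]
    congr 1
    ext b
    simp only [AddSubgroup.mem_inf, AddMonoidHom.mem_range, AddSubgroup.mem_map]
    constructor
    · rintro ⟨⟨a, rfl⟩, hb⟩
      refine ⟨a, ?_, rfl⟩
      rw [← h]
      exact hb
    · rintro ⟨a, ha, rfl⟩
      exact ⟨⟨a, rfl⟩, AddCommGroup.le_comap_torsion f ha⟩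
  · -- `f(A) ⊔ T_B` is the preimage of `f̄(A/T_A)` under `B → B/T_B`
    have hrange : (QuotientAddGroup.map (AddCommGroup.torsion A) (AddCommGroup.torsion B) f
          h.ge).range = (f.range).map (QuotientAddGroup.mk' (AddCommGroup.torsion B)) := by
      apply le_antisymm
      · rintro _ ⟨x, rfl⟩
        induction x using QuotientAddGroup.induction_on with
        | H a => exact ⟨f a, ⟨a, rfl⟩, rfl⟩
      · rintro _ ⟨_, ⟨a, rfl⟩, rfl⟩
        exact ⟨QuotientAddGroup.mk a, rfl⟩
    rw [hrange, ← AddSubgroup.index_comap_of_surjective _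
      (QuotientAddGroup.mk'_surjective (AddCommGroup.torsion B)),
      AddSubgroup.comap_map_eq, QuotientAddGroup.ker_mk']

/-- **The Mordell–Weil term of Milne's proof of Thm. I.7.3.** For homomorphisms `f : A → B`,
`g : B → A` whose kernels are torsion and which pull torsion back to torsion (e.g. `g ∘ f = [m]`,
`f ∘ g = [m]`, `m ≠ 0`), with finite torsion subgroups `T_A`, `T_B` and induced maps
`f̄ : A/T_A → B/T_B`, `ḡ : B/T_B → A/T_A`:
`#ker f · [A : g(B)] · #T_B² · [B/T_B : f̄(A/T_A)] = #ker g · [B : f(A)] · #T_A² · [A/T_A : ḡ(B/T_B)]`,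
i.e. `z(f)/z(g) = (#T_A/#T_B)² · [A/T_A : ḡ(B/T_B)] / [B/T_B : f̄(A/T_A)]` with
`z = [Ker]/[Coker]` — the two displayed formulas `z(f(K)) = (A(K) : Σℤaᵢ)/(B(K) : Σℤbᵢ)`,
`z(f^t(K)) = (B^t(K) : Σℤb'ᵢ)/(A^t(K) : Σℤa'ᵢ)` of Milne's proof (*ADT*, p. 97), phrased through
the torsion subgroups. [cite: MilneADT2006, Ch. I, proof of Thm. 7.3, p. 97] -/
theorem card_ker_mul_index_mul_card_torsion_sq_mul_index_eq (g : B →+ A)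
    [Finite (AddCommGroup.torsion A)] [Finite (AddCommGroup.torsion B)]
    (hkf : f.ker ≤ AddCommGroup.torsion A) (hkg : g.ker ≤ AddCommGroup.torsion B)
    (hf : (AddCommGroup.torsion B).comap f = AddCommGroup.torsion A)
    (hg : (AddCommGroup.torsion A).comap g = AddCommGroup.torsion B) :
    Nat.card f.ker * g.range.index * Nat.card (AddCommGroup.torsion B) ^ 2 *
        (QuotientAddGroup.map (AddCommGroup.torsion A) (AddCommGroup.torsion B) f
          hf.ge).range.index =
      Nat.card g.ker * f.range.index * Nat.card (AddCommGroup.torsion A) ^ 2 *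
        (QuotientAddGroup.map (AddCommGroup.torsion B) (AddCommGroup.torsion A) g
          hg.ge).range.index := by
  have h1 := card_ker_mul_card_torsion_eq f hkf
  have h2 := card_ker_mul_card_torsion_eq g hkg
  rw [index_range_eq_relIndex_mul_index_range_map f hf,
    index_range_eq_relIndex_mul_index_range_map g hg]
  set a := Nat.card f.ker
  set a' := Nat.card g.ker
  set t := Nat.card (AddCommGroup.torsion A)
  set t' := Nat.card (AddCommGroup.torsion B)
  set u := ((AddCommGroup.torsion A).map f).relIndex (AddCommGroup.torsion B)
  set u' := ((AddCommGroup.torsion B).map g).relIndex (AddCommGroup.torsion A)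
  set i := (QuotientAddGroup.map (AddCommGroup.torsion A) (AddCommGroup.torsion B) f
    hf.ge).range.index
  set i' := (QuotientAddGroup.map (AddCommGroup.torsion B) (AddCommGroup.torsion A) g
    hg.ge).range.index
  calc a * (u' * i') * t' ^ 2 * i = (u' * t') * (a * t') * (i' * i) := by ring
    _ = (a' * t) * (u * t) * (i' * i) := by rw [h1, h2]
    _ = a' * (u * i) * t ^ 2 * i' := by ring

end IndexCalculus

/-! ## The height term: Gram determinants of adjoint maps -/

section Gram

variable {Λ Λ' : Type*} [AddCommGroup Λ] [AddCommGroup Λ'] {ι : Type*} [Fintype ι]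
  {S : Type*} [CommRing S]

/-- **Adjoint maps have transposed matrices with respect to Gram matrices**: for `ℤ`-bilinear forms
`β` on `Λ`, `β'` on `Λ'`, homomorphisms `u : Λ → Λ'`, `v : Λ' → Λ` with `β'(u x, y) = β(x, v y)`,
and `ℤ`-bases `b` of `Λ`, `c` of `Λ'`: `Fᵀ · Gram(β', c) = Gram(β, b) · G`, where
`F = c.toMatrix (u ∘ b)` and `G = b.toMatrix (v ∘ c)` are the matrices of `u` and `v`. Matrix form
of "the functoriality of the height pairings shows that `⟨f^t(b'ⱼ), aᵢ⟩ = ⟨b'ⱼ, f(aᵢ)⟩`" in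
Milne's proof of *ADT* Thm. I.7.3 (p. 97). [cite: MilneADT2006, Ch. I, proof of Thm. 7.3, p. 97] -/
theorem transpose_toMatrix_mul_gram_eq (β : Λ →ₗ[ℤ] Λ →ₗ[ℤ] S) (β' : Λ' →ₗ[ℤ] Λ' →ₗ[ℤ] S)
    (u : Λ →+ Λ') (v : Λ' →+ Λ) (hadj : ∀ x y, β' (u x) y = β x (v y))
    (b : Basis ι ℤ Λ) (c : Basis ι ℤ Λ') :
    ((c.toMatrix (u ∘ b)).transpose.map (Int.castRingHom S)) *
        Matrix.of (fun i j => β' (c i) (c j)) =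
      Matrix.of (fun i j => β (b i) (b j)) * (b.toMatrix (v ∘ c)).map (Int.castRingHom S) := by
  ext i j
  have hl : β' (u (b i)) (c j) = ∑ k, (c.repr (u (b i)) k : S) * β' (c k) (c j) := by
    conv_lhs => rw [← c.sum_repr (u (b i))]
    simp only [map_sum, map_zsmul, LinearMap.coe_sum, Finset.sum_apply, LinearMap.smul_apply,
      zsmul_eq_mul]
  have hr : β (b i) (v (c j)) = ∑ k, (b.repr (v (c j)) k : S) * β (b i) (b k) := by
    conv_lhs => rw [← b.sum_repr (v (c j))]
    simp only [map_sum, map_zsmul, zsmul_eq_mul]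
  have h := hadj (b i) (c j)
  rw [hl, hr] at h
  simp only [Matrix.mul_apply, Matrix.map_apply, Matrix.transpose_apply, Matrix.of_apply,
    Basis.toMatrix_apply, Function.comp_apply, eq_intCast]
  rw [h]
  exact Finset.sum_congr rfl fun k _ ↦ by ring

variable [DecidableEq ι]

/-- Determinant form of `transpose_toMatrix_mul_gram_eq`:
`det(c; u ∘ b) · det Gram(β', c) = det Gram(β, b) · det(b; v ∘ c)` — Milne's
"`det⟨a'ⱼ, aᵢ⟩ = det⟨b'ⱼ, bᵢ⟩`" (*ADT* p. 97) before the bases are specialised to `bᵢ = f(aᵢ)`,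
`a'ᵢ = f^t(b'ᵢ)`. [cite: MilneADT2006, Ch. I, proof of Thm. 7.3, p. 97] -/
theorem det_toMatrix_mul_det_gram_eq (β : Λ →ₗ[ℤ] Λ →ₗ[ℤ] S) (β' : Λ' →ₗ[ℤ] Λ' →ₗ[ℤ] S)
    (u : Λ →+ Λ') (v : Λ' →+ Λ) (hadj : ∀ x y, β' (u x) y = β x (v y))
    (b : Basis ι ℤ Λ) (c : Basis ι ℤ Λ') :
    (c.det (u ∘ b) : S) * (Matrix.of fun i j => β' (c i) (c j)).det =
      (Matrix.of fun i j => β (b i) (b j)).det * (b.det (v ∘ c) : S) := by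
  have h := congrArg Matrix.det (transpose_toMatrix_mul_gram_eq β β' u v hadj b c)
  rw [Matrix.det_mul, Matrix.det_mul, ← RingHom.mapMatrix_apply, ← RingHom.mapMatrix_apply,
    ← RingHom.map_det, ← RingHom.map_det, Matrix.det_transpose] at h
  rw [Basis.det_apply, Basis.det_apply]
  simpa using h

/-- **The index of a full sublattice is the absolute determinant of a matrix of generators**
(Mathlib's `AddSubgroup.index_eq_natAbs_det`, arranged for an injective homomorphism): for
`u : Λ → Λ'` injective and `ℤ`-bases `b` of `Λ`, `c` of `Λ'` on the same finite index type,
`[Λ' : u(Λ)] = |det(c; u ∘ b)|`. This computes "`(B(K) : Σℤbᵢ)`" in Milne's proof of *ADT*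
Thm. I.7.3 (p. 97). [folklore] -/
theorem index_range_eq_natAbs_det (u : Λ →+ Λ') (hu : Function.Injective u)
    (b : Basis ι ℤ Λ) (c : Basis ι ℤ Λ') :
    u.range.index = (c.det (u ∘ b)).natAbs := by
  let e : Λ ≃ₗ[ℤ] u.range := (AddMonoidHom.ofInjective hu).toIntLinearEquiv
  rw [AddSubgroup.index_eq_natAbs_det c u.range (b.map e)]
  rfl

/-- **Regulators of adjoint lattices**: with `β, β', u, v, b, c` as in
`det_toMatrix_mul_det_gram_eq`, `u` and `v` injective and both Gram determinants non-negative
(e.g. positive definite height pairings),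
`[Λ' : u(Λ)] · det Gram(β', c) = det Gram(β, b) · [Λ : v(Λ')]` — the combination of
"`det⟨a'ⱼ, aᵢ⟩ = det⟨b'ⱼ, bᵢ⟩`" with the indices `(A(K) : Σℤaᵢ)`, `(B(K) : Σℤbᵢ)` in Milne's proof of
*ADT* Thm. I.7.3 (p. 97). [cite: MilneADT2006, Ch. I, proof of Thm. 7.3, p. 97] -/
theorem index_mul_det_gram_eq (β : Λ →ₗ[ℤ] Λ →ₗ[ℤ] ℝ) (β' : Λ' →ₗ[ℤ] Λ' →ₗ[ℤ] ℝ)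
    (u : Λ →+ Λ') (v : Λ' →+ Λ) (hu : Function.Injective u) (hv : Function.Injective v)
    (hadj : ∀ x y, β' (u x) y = β x (v y)) (b : Basis ι ℤ Λ) (c : Basis ι ℤ Λ')
    (hb : 0 ≤ (Matrix.of fun i j => β (b i) (b j)).det)
    (hc : 0 ≤ (Matrix.of fun i j => β' (c i) (c j)).det) :
    (u.range.index : ℝ) * (Matrix.of fun i j => β' (c i) (c j)).det =
      (Matrix.of fun i j => β (b i) (b j)).det * (v.range.index : ℝ) := by
  have h := congrArg abs (det_toMatrix_mul_det_gram_eq β β' u v hadj b c)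
  rw [abs_mul, abs_mul, abs_of_nonneg hb, abs_of_nonneg hc] at h
  rw [index_range_eq_natAbs_det u hu b c, index_range_eq_natAbs_det v hv c b,
    Nat.cast_natAbs, Nat.cast_natAbs, Int.cast_abs, Int.cast_abs]
  exact h

end Gram

end Literature.NumberTheory.EllipticCurves

/-! ## The regulator term for elliptic curves over a number field -/

namespace WeierstrassCurve

open Literature.NumberTheory.EllipticCurves Affine.Point

section NumberField

variable {K : Type u} [Field K] [NumberField K] {W W' : WeierstrassCurve K}

/-- **The regulator term of Milne's Thm. I.7.3 for elliptic curves over a number field.** Let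
`f : E(K) → E'(K)` and `g : E'(K) → E(K)` be homomorphisms which pull the torsion subgroup back
to the torsion subgroup (so that the induced maps `f̄ : E(K)/tors → E'(K)/tors`,
`ḡ : E'(K)/tors → E(K)/tors` are injective — e.g. the maps induced by an isogeny and its dual) and
which are **adjoint for the Néron–Tate height pairings**, `⟨f P, Q⟩_{E'} = ⟨P, g Q⟩_E`
(the "functoriality of the height pairings", Milne, *ADT*, proof of Thm. I.7.3, p. 97). Then
`[E'(K)/tors : f̄(E(K)/tors)] · Reg(E'/K) = Reg(E/K) · [E(K)/tors : ḡ(E'(K)/tors)]`.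
This is Milne's "`det⟨a'ⱼ, aᵢ⟩ = det⟨b'ⱼ, bᵢ⟩`" combined with the indices `(A(K) : Σℤaᵢ)`,
`(B(K) : Σℤbᵢ)` of the two boxed formulas for `z(f(K))`, `z(f^t(K))` (p. 97), in the tree's
normalisation `Reg = det⟨Pᵢ, Pⱼ⟩` on a Mordell–Weil basis (`WeierstrassCurve.regulator`; the
Mordell–Weil theorem, the descent of the pairing to `E(K)/tors` and `Reg > 0` are the tree's
`exists_isMordellWeilBasis_holds`, `exists_bilinMap_heightPairing`, `regulator_pos'`).
[cite: MilneADT2006, Ch. I, proof of Thm. 7.3, p. 97] -/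
theorem index_mul_regulator_eq_regulator_mul_index [W.IsElliptic] [W'.IsElliptic]
    (f : W.toAffine.Point →+ W'.toAffine.Point) (g : W'.toAffine.Point →+ W.toAffine.Point)
    (hf : (AddCommGroup.torsion W'.toAffine.Point).comap f =
      AddCommGroup.torsion W.toAffine.Point)
    (hg : (AddCommGroup.torsion W.toAffine.Point).comap g =
      AddCommGroup.torsion W'.toAffine.Point)
    (hadj : ∀ (P : W.toAffine.Point) (Q : W'.toAffine.Point),
      heightPairing (f P) Q = heightPairing P (g Q)) :
    ((QuotientAddGroup.map _ _ f hf.ge).range.index : ℝ) * W'.regulator =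
      W.regulator * (QuotientAddGroup.map _ _ g hg.ge).range.index := by
  -- the induced maps on the free quotients are injective
  set fb := QuotientAddGroup.map _ _ f hf.ge with hfb
  set gb := QuotientAddGroup.map _ _ g hg.ge with hgb
  have hfinj : Function.Injective fb := by
    rw [← AddMonoidHom.ker_eq_bot_iff, hfb, QuotientAddGroup.ker_map, hf,
      AddSubgroup.map_eq_bot_iff, QuotientAddGroup.ker_mk']
  have hginj : Function.Injective gb := by
    rw [← AddMonoidHom.ker_eq_bot_iff, hgb, QuotientAddGroup.ker_map, hg,
      AddSubgroup.map_eq_bot_iff, QuotientAddGroup.ker_mk']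
  -- Mordell–Weil bases and the descended pairings
  obtain ⟨P, hP⟩ := exists_isMordellWeilBasis_holds W
  obtain ⟨P', hP'⟩ := exists_isMordellWeilBasis_holds W'
  let b : Basis (Fin W.mordellWeilRank) ℤ (mordellWeilModTorsion W) := Basis.mk hP.1 hP.2.ge
  have hb : ∀ i, b i = QuotientAddGroup.mk (P i) := fun i ↦ Basis.mk_apply _ _ i
  let c₀ : Basis (Fin W'.mordellWeilRank) ℤ (mordellWeilModTorsion W') := Basis.mk hP'.1 hP'.2.ge
  have hc₀ : ∀ i, c₀ i = QuotientAddGroup.mk (P' i) := fun i ↦ Basis.mk_apply _ _ i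
  -- the ranks agree (injections both ways between finite free `ℤ`-modules)
  haveI : Module.Finite ℤ (mordellWeilModTorsion W) := Module.Finite.of_basis b
  haveI : Module.Finite ℤ (mordellWeilModTorsion W') := Module.Finite.of_basis c₀
  have hr : W.mordellWeilRank = W'.mordellWeilRank := by
    have h₁ := LinearMap.finrank_le_finrank_of_injective (f := fb.toIntLinearMap) hfinj
    have h₂ := LinearMap.finrank_le_finrank_of_injective (f := gb.toIntLinearMap) hginj
    rw [Module.finrank_eq_card_basis b, Module.finrank_eq_card_basis c₀, Fintype.card_fin,
      Fintype.card_fin] at h₁ h₂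
    exact le_antisymm h₁ h₂
  let e : Fin W.mordellWeilRank ≃ Fin W'.mordellWeilRank := finCongr hr
  let c : Basis (Fin W.mordellWeilRank) ℤ (mordellWeilModTorsion W') := c₀.reindex e.symm
  have hc : ∀ i, c i = QuotientAddGroup.mk (P' (e i)) := fun i ↦ by
    rw [Basis.reindex_apply, Equiv.symm_symm, hc₀]
  obtain ⟨β, hβ⟩ := exists_bilinMap_heightPairing (W := W)
  obtain ⟨β', hβ'⟩ := exists_bilinMap_heightPairing (W := W')
  -- Gram determinants are the regulators
  have hR : (Matrix.of fun i j => β (b i) (b j)).det = W.regulator := by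
    rw [← regulatorOf_eq_det_of_bilinMap hβ P b hb, hP.regulatorOf_eq_regulator]
  have hR' : (Matrix.of fun i j => β' (c i) (c j)).det = W'.regulator := by
    rw [← regulatorOf_eq_det_of_bilinMap hβ' (P' ∘ e) c (fun i ↦ hc i)]
    have := regulatorOf_reindex e.symm P'
    rw [Equiv.symm_symm] at this
    rw [this, hP'.regulatorOf_eq_regulator]
  -- adjunction on the quotients
  have hadj' : ∀ x y, β' (fb x) y = β x (gb y) := by
    intro x y
    induction x using QuotientAddGroup.induction_on with
    | H Q =>
      induction y using QuotientAddGroup.induction_on with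
      | H R =>
        rw [hfb, hgb, QuotientAddGroup.map_mk, QuotientAddGroup.map_mk, hβ, hβ', hadj]
  have key := index_mul_det_gram_eq β β' fb gb hfinj hginj hadj' b c
    (hR ▸ (regulator_pos' W).le) (hR' ▸ (regulator_pos' W').le)
  rwa [hR, hR'] at key

end NumberField

/-! ## Theorem 7.3 modulo (H), (Ш) and (7.3.1) -/

namespace Isogeny

variable {K : Type u} [Field K] {W W' : WeierstrassCurve K}

/-- The map on rational points of an isogeny `φ` followed by that of an isogeny `ψ` with
`ψ ∘ φ = [m]` is multiplication by `m` on `E(K)` (the maps on rational points being characterised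
by their compatibility with `E(K) ↪ E(K̄)`, `WeierstrassCurve.Isogeny.exists_pointHom`).
Silverman, *AEC*, III.6.2(a). [folklore] -/
theorem pointHom_comp_eq_nsmul (φ : Isogeny W W') (ψ : Isogeny W' W) {m : ℕ}
    (hψφ : ∀ P : W.geomPoints, ψ (φ P) = (m : ℤ) • P)
    {f : W.toAffine.Point →+ W'.toAffine.Point}
    (hf : ∀ P, W'.toGeomPoints (f P) = φ (W.toGeomPoints P))
    {g : W'.toAffine.Point →+ W.toAffine.Point}
    (hg : ∀ Q, W.toGeomPoints (g Q) = ψ (W'.toGeomPoints Q)) (P : W.toAffine.Point) :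
    g (f P) = m • P := by
  apply toGeomPoints_injective W
  rw [hg, hf, hψφ, ← natCast_zsmul, map_zsmul]

/-- If `ψ ∘ φ = [m]` on `E(K̄)` then `φ ∘ ψ = [m]` on `E'(K̄)` (`φ` is onto `K̄`-points,
`Isogeny.surjective`). Silverman, *AEC*, Thm. III.6.2(a) (`φ ∘ φ̂ = [m]` on `E'`).
[cite: SilvermanAEC2009, Thm. III.6.2(a)] -/
theorem comp_eq_zsmul_of_comp_eq_zsmul [W.IsElliptic] [W'.IsElliptic] (φ : Isogeny W W')
    (ψ : Isogeny W' W) {m : ℕ} (hψφ : ∀ P : W.geomPoints, ψ (φ P) = (m : ℤ) • P)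
    (Q : W'.geomPoints) : φ (ψ Q) = (m : ℤ) • Q := by
  obtain ⟨P, rfl⟩ := φ.surjective Q
  rw [hψφ, map_zsmul]

/-- **Milne's Theorem I.7.3 for elliptic curves over a number field, reduced to its cohomological
inputs.** Let `φ : E → E'` be a `K`-isogeny of elliptic curves over a number field,
`ψ : E' → E` an isogeny with `ψ ∘ φ = [m]`, `m ≠ 0` (the dual isogeny,
`Isogeny.exists_dual_of_isElliptic`), `f = φ(K) : E(K) → E'(K)` and `g = ψ(K) : E'(K) → E(K)` the
induced maps on rational points, and assume
* (H) `f` and `g` are adjoint for the Néron–Tate pairings, `⟨f P, Q⟩_{E'} = ⟨P, g Q⟩_E` — "the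
  functoriality of the height pairings" (p. 97);
* (Ш) `#Ш(E) · #ker Ш(ψ) = #Ш(E') · #ker Ш(φ)` — the boxed formula
  `[Ш(A)]/[Ш(B)] = [Ker Ш(f)]/[Ker Ш(f^t)]` (p. 98), which Milne derives from the non-degeneracy
  of the two Cassels–Tate pairings (I.6.13(a)) and the adjointness of `Ш(f)`, `Ш(f^t)` for them;
* (7.3.1) for two real numbers `x`, `x'` (in Milne's proof
  `x/x' = ∏_{v ∈ S} z(f(K_v)) = ∏_{v ∈ S} μ_v(A, ω_A)/μ_v(B, ω_B)`, p. 98):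
  `x · #ker Ш(φ) · #ker g · [E'(K) : f(E(K))] = x' · #ker Ш(ψ) · #ker f · [E(K) : g(E'(K))]`,
  i.e. `x/x' = ([Ker Ш(f^t)]/[Ker Ш(f)]) · (z(f(K))/z(f^t(K)))` with `z = [Ker]/[Coker]` — formula
  (7.3.1), p. 98, which Milne proves from Tate local duality, the Poitou–Tate sequence (I.4.10)
  and the global Euler characteristic formula (I.5.2a), pp. 99–100.

Then, if `Ш(E/K)` is finite,
`#Ш(E') · Reg(E') · x' · #E(K)_tors² = #Ш(E) · Reg(E) · x · #E'(K)_tors²`.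
Everything else in Milne's proof — Lemma 7.2, the Mordell–Weil diagram for `z(f(K))`,
`z(f^t(K))`, the determinant comparison `det⟨a'ⱼ, aᵢ⟩ = det⟨b'ⱼ, bᵢ⟩`, the finiteness of `Ш(E')`
(Lemma 7.1(b), tree `Isogeny.shaFinite_iff_shaFinite`) and of all the indices — is proved here,
in the tree's normalisations (`Reg = det⟨Pᵢ, Pⱼ⟩` on a Mordell–Weil basis,
`#E(K)_tors² = [A(K)_tors][A^t(K)_tors]` for `A = A^t = E`); `Ш(φ)` is the tree's
`Literature.NumberTheory.EllipticCurves.shaMap`.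
[cite: MilneADT2006, Ch. I, Thm. 7.3 and its proof, (7.3.1), pp. 97–100] -/
theorem card_sha_mul_regulator_mul_eq_of_keyIdentity [NumberField K] [W.IsElliptic]
    [W'.IsElliptic] (φ : Isogeny W W') (ψ : Isogeny W' W)
    {m : ℕ} (hm : m ≠ 0) (hψφ : ∀ P : W.geomPoints, ψ (φ P) = (m : ℤ) • P)
    (f : W.toAffine.Point →+ W'.toAffine.Point)
    (hf : ∀ P, W'.toGeomPoints (f P) = φ (W.toGeomPoints P))
    (g : W'.toAffine.Point →+ W.toAffine.Point)
    (hg : ∀ Q, W.toGeomPoints (g Q) = ψ (W'.toGeomPoints Q))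
    (hadj : ∀ (P : W.toAffine.Point) (Q : W'.toAffine.Point),
      heightPairing (f P) Q = heightPairing P (g Q))
    (hSha : Nat.card W.sha *
        Nat.card (shaMap ψ.toAddMonoidHom ψ.equivariant ψ.hasLocalPointsMaps_toAddMonoidHom).ker =
      Nat.card W'.sha *
        Nat.card (shaMap φ.toAddMonoidHom φ.equivariant φ.hasLocalPointsMaps_toAddMonoidHom).ker)
    (x x' : ℝ)
    (h731 : x *
        Nat.card (shaMap φ.toAddMonoidHom φ.equivariant φ.hasLocalPointsMaps_toAddMonoidHom).ker *
          Nat.card g.ker * f.range.index =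
      x' *
        Nat.card (shaMap ψ.toAddMonoidHom ψ.equivariant ψ.hasLocalPointsMaps_toAddMonoidHom).ker *
          Nat.card f.ker * g.range.index)
    (hfin : W.ShaFinite) :
    (Nat.card W'.sha : ℝ) * W'.regulator * x' *
        (Nat.card (AddCommGroup.torsion W.toAffine.Point) : ℝ) ^ 2 =
      (Nat.card W.sha : ℝ) * W.regulator * x *
        (Nat.card (AddCommGroup.torsion W'.toAffine.Point) : ℝ) ^ 2 := by
  -- `g ∘ f = [m]` on `E(K)` and `f ∘ g = [m]` on `E'(K)`
  have hgf : ∀ P, g (f P) = m • P := pointHom_comp_eq_nsmul φ ψ hψφ hf hg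
  have hfg : ∀ Q, f (g Q) = m • Q :=
    pointHom_comp_eq_nsmul ψ φ (comp_eq_zsmul_of_comp_eq_zsmul φ ψ hψφ) hg hf
  -- torsion bookkeeping hypotheses
  have hkf := ker_le_torsion_of_comp_eq_nsmul f g hm hgf
  have hkg := ker_le_torsion_of_comp_eq_nsmul g f hm hfg
  have hfT := comap_torsion_eq_of_comp_eq_nsmul f g hm hgf
  have hgT := comap_torsion_eq_of_comp_eq_nsmul g f hm hfg
  -- finiteness (Mordell–Weil, finite torsion, Lemma 7.1(b))
  haveI : Finite (AddCommGroup.torsion W.toAffine.Point) := finite_torsion_holds W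
  haveI : Finite (AddCommGroup.torsion W'.toAffine.Point) := finite_torsion_holds W'
  haveI : Finite W.sha := hfin
  haveI : Finite W'.sha := (φ.shaFinite_iff_shaFinite).mp hfin
  haveI : AddGroup.FG W.toAffine.Point := addGroup_fg_point_holds W
  haveI : AddGroup.FG W'.toAffine.Point := addGroup_fg_point_holds W'
  -- the two proved terms: Mordell–Weil bookkeeping and regulators
  have hB := card_ker_mul_index_mul_card_torsion_sq_mul_index_eq f g hkf hkg hfT hgT
  have hC := index_mul_regulator_eq_regulator_mul_index f g hfT hgT hadj
  -- non-vanishing of the indices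
  have hc : f.range.index ≠ 0 := by
    haveI : Finite (W'.toAffine.Point ⧸ f.range) := by
      refine AddCommGroup.finite_of_fg_torsion _ fun y ↦ ?_
      induction y using QuotientAddGroup.induction_on with
      | H Q =>
        rw [isOfFinAddOrder_iff_nsmul_eq_zero]
        refine ⟨m, Nat.pos_of_ne_zero hm, ?_⟩
        rw [← QuotientAddGroup.mk_nsmul, ← hfg, QuotientAddGroup.eq_zero_iff]
        exact ⟨g Q, rfl⟩
    exact AddSubgroup.index_ne_zero_of_finite
  have hc' : g.range.index ≠ 0 := by
    haveI : Finite (W.toAffine.Point ⧸ g.range) := by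
      refine AddCommGroup.finite_of_fg_torsion _ fun y ↦ ?_
      induction y using QuotientAddGroup.induction_on with
      | H P =>
        rw [isOfFinAddOrder_iff_nsmul_eq_zero]
        refine ⟨m, Nat.pos_of_ne_zero hm, ?_⟩
        rw [← QuotientAddGroup.mk_nsmul, ← hgf, QuotientAddGroup.eq_zero_iff]
        exact ⟨f P, rfl⟩
    exact AddSubgroup.index_ne_zero_of_finite
  have hi : (QuotientAddGroup.map _ _ f hfT.ge).range.index ≠ 0 := by
    have h := index_range_eq_relIndex_mul_index_range_map f hfT
    rw [h] at hc
    exact (Nat.mul_ne_zero_iff.mp hc).2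
  have hi' : (QuotientAddGroup.map _ _ g hgT.ge).range.index ≠ 0 := by
    have h := index_range_eq_relIndex_mul_index_range_map g hgT
    rw [h] at hc'
    exact (Nat.mul_ne_zero_iff.mp hc').2
  have ha : Nat.card f.ker ≠ 0 := by
    haveI : Finite f.ker := Finite.of_injective _ (AddSubgroup.inclusion_injective hkf)
    exact Nat.card_pos.ne'
  have ha' : Nat.card g.ker ≠ 0 := by
    haveI : Finite g.ker := Finite.of_injective _ (AddSubgroup.inclusion_injective hkg)
    exact Nat.card_pos.ne'
  have hkφ : Nat.card
      (shaMap φ.toAddMonoidHom φ.equivariant φ.hasLocalPointsMaps_toAddMonoidHom).ker ≠ 0 := by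
    haveI : Finite (shaMap φ.toAddMonoidHom φ.equivariant φ.hasLocalPointsMaps_toAddMonoidHom).ker :=
      Finite.of_injective _ Subtype.val_injective
    exact Nat.card_pos.ne'
  have hkψ : Nat.card
      (shaMap ψ.toAddMonoidHom ψ.equivariant ψ.hasLocalPointsMaps_toAddMonoidHom).ker ≠ 0 := by
    haveI : Finite (shaMap ψ.toAddMonoidHom ψ.equivariant ψ.hasLocalPointsMaps_toAddMonoidHom).ker :=
      Finite.of_injective _ Subtype.val_injective
    exact Nat.card_pos.ne'
  -- the algebra, in `ℝ`
  have hB' := congrArg (Nat.cast (R := ℝ)) hB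
  have hSha' := congrArg (Nat.cast (R := ℝ)) hSha
  push_cast at hB' hSha'
  have hM : (Nat.card (shaMap φ.toAddMonoidHom φ.equivariant
      φ.hasLocalPointsMaps_toAddMonoidHom).ker : ℝ) *
      ((QuotientAddGroup.map _ _ f hfT.ge).range.index : ℝ) *
      (Nat.card (shaMap ψ.toAddMonoidHom ψ.equivariant
        ψ.hasLocalPointsMaps_toAddMonoidHom).ker : ℝ) *
      (Nat.card f.ker : ℝ) * (g.range.index : ℝ) * (Nat.card g.ker : ℝ) * (f.range.index : ℝ) *
      ((QuotientAddGroup.map _ _ g hgT.ge).range.index : ℝ) ≠ 0 := by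
    simp only [ne_eq, mul_eq_zero, Nat.cast_eq_zero, not_or]
    exact ⟨⟨⟨⟨⟨⟨⟨hkφ, hi⟩, hkψ⟩, ha⟩, hc'⟩, ha'⟩, hc⟩, hi'⟩
  set a := (Nat.card f.ker : ℝ)
  set a' := (Nat.card g.ker : ℝ)
  set c := (f.range.index : ℝ)
  set c' := (g.range.index : ℝ)
  set t := (Nat.card (AddCommGroup.torsion W.toAffine.Point) : ℝ)
  set t' := (Nat.card (AddCommGroup.torsion W'.toAffine.Point) : ℝ)
  set i := ((QuotientAddGroup.map _ _ f hfT.ge).range.index : ℝ)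
  set i' := ((QuotientAddGroup.map _ _ g hgT.ge).range.index : ℝ)
  set kφ := (Nat.card
    (shaMap φ.toAddMonoidHom φ.equivariant φ.hasLocalPointsMaps_toAddMonoidHom).ker : ℝ)
  set kψ := (Nat.card
    (shaMap ψ.toAddMonoidHom ψ.equivariant ψ.hasLocalPointsMaps_toAddMonoidHom).ker : ℝ)
  set S := (Nat.card W.sha : ℝ)
  set S' := (Nat.card W'.sha : ℝ)
  set R := W.regulator
  set R' := W'.regulator
  have key : (kφ * i * kψ * a * c' * a' * c * i') * (S' * R' * x' * t ^ 2) =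
      (kφ * i * kψ * a * c' * a' * c * i') * (S * R * x * t' ^ 2) := by
    linear_combination (R' * i) * (x' * kψ * a * c') * (t ^ 2 * a' * c * i') * hSha'.symm +
      (S * kψ) * (x' * kψ * a * c') * (t ^ 2 * a' * c * i') * hC +
      (S * kψ) * (R * i') * (t ^ 2 * a' * c * i') * h731.symm +
      (S * kψ) * (R * i') * (x * kφ * a' * c) * hB'.symm
  exact mul_left_cancel₀ hM key

end Isogeny

/-! ## Over `ℚ`: the Birch–Swinnerton-Dyer quotient `WeierstrassCurve.bsdRHS` -/

section Rat

variable {W W' : WeierstrassCurve ℚ}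

/-- **Cassels' theorem — isogeny invariance of the Birch–Swinnerton-Dyer quotient over `ℚ`
(`WeierstrassCurve.bsdRHS_eq_of_isIsogenous`) — reduced to Milne's formula (7.3.1) and the
Cassels–Tate step.** For a `ℚ`-isogeny `φ : E → E'` of elliptic curves with dual `ψ`
(`ψ ∘ φ = [m]`, `m ≠ 0`), induced maps `f = φ(ℚ)`, `g = ψ(ℚ)` on rational points adjoint for the
Néron–Tate pairings (H), the Cassels–Tate relation (Ш) `#Ш(E) · #ker Ш(ψ) = #Ш(E') · #ker Ш(φ)`,
and formula (7.3.1) with its left-hand side `∏_{v ∈ S} z(φ(ℚ_v)) = ∏_{v ∈ S} μ_v(E, φ^*ω')/μ_v(E', ω')`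
evaluated, for globally minimal `E`, `E'`, as `Ω(E) ∏_p c_p(E) / (Ω(E') ∏_p c_p(E'))` (Milne, *ADT*,
p. 98: `z(f(K_v)) = μ_v(A, ω_A)/μ_v(B, ω_B)` with `ω_A = f^*ω_B`; here `φ^*ω' = αω` with
`α ∈ ℚ^×`, `μ_p(E, ω) = c_p · #Ẽ_ns(𝔽_p)/p`, `μ_∞(E, ω) = Ω(E)`, the local factors of isogenous
curves agree and `∏_v |α|_v = 1`):
`Ω(E) ∏c_p(E) · #ker Ш(φ) · #ker g · [E'(ℚ) : f(E(ℚ))] = Ω(E') ∏c_p(E') · #ker Ш(ψ) · #ker f · [E(ℚ) : g(E'(ℚ))]`.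
If moreover `Ш(E/ℚ)` is finite, then `E` and `E'` have the same Birch–Swinnerton-Dyer quotient
`#Ш · Reg · Ω · ∏ c_p / #E(ℚ)_tors²` (`WeierstrassCurve.bsdRHS`) — the conclusion of the named fact
`bsdRHS_eq_of_isIsogenous` for this pair (its other conclusion, finiteness of `Ш(E'/ℚ)`, is the
tree's `Isogeny.shaFinite_iff_shaFinite`). The statement is polymorphic in the `DecidableEq ℚ`
instance underlying the group law on `E(ℚ)`. What separates this theorem from
`bsdRHS_eq_of_isIsogenous_holds` is exactly (H), (Ш) and (7.3.1) with the local volume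
computation, none of which is in Mathlib or the tree.
[cite: MilneADT2006, Ch. I, Thm. 7.3 and its proof, (7.3.1), pp. 97–100] -/
theorem bsdRHS_eq_of_keyIdentity [DecidableEq ℚ] [W.IsElliptic] [W'.IsElliptic]
    (φ : Isogeny W W') (ψ : Isogeny W' W)
    {m : ℕ} (hm : m ≠ 0) (hψφ : ∀ P : W.geomPoints, ψ (φ P) = (m : ℤ) • P)
    (f : W.toAffine.Point →+ W'.toAffine.Point)
    (hf : ∀ P, W'.toGeomPoints (f P) = φ (W.toGeomPoints P))
    (g : W'.toAffine.Point →+ W.toAffine.Point)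
    (hg : ∀ Q, W.toGeomPoints (g Q) = ψ (W'.toGeomPoints Q))
    (hadj : ∀ (P : W.toAffine.Point) (Q : W'.toAffine.Point),
      heightPairing (f P) Q = heightPairing P (g Q))
    (hSha : Nat.card W.sha *
        Nat.card (shaMap ψ.toAddMonoidHom ψ.equivariant ψ.hasLocalPointsMaps_toAddMonoidHom).ker =
      Nat.card W'.sha *
        Nat.card (shaMap φ.toAddMonoidHom φ.equivariant φ.hasLocalPointsMaps_toAddMonoidHom).ker)
    (h731 : W.realPeriodRat * W.tamagawaProduct *
        Nat.card (shaMap φ.toAddMonoidHom φ.equivariant φ.hasLocalPointsMaps_toAddMonoidHom).ker *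
          Nat.card g.ker * f.range.index =
      W'.realPeriodRat * W'.tamagawaProduct *
        Nat.card (shaMap ψ.toAddMonoidHom ψ.equivariant ψ.hasLocalPointsMaps_toAddMonoidHom).ker *
          Nat.card f.ker * g.range.index)
    (hfin : W.ShaFinite) : W'.bsdRHS = W.bsdRHS := by
  -- bridge the `DecidableEq ℚ` instance to the classical one of the general theorems
  obtain rfl : ‹DecidableEq ℚ› = fun a b ↦ Classical.propDecidable (a = b) :=
    Subsingleton.elim _ _
  have key := Isogeny.card_sha_mul_regulator_mul_eq_of_keyIdentity φ ψ hm hψφ f hf g hg hadj hSha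
    _ _ h731 hfin
  have ht : (W.torsionOrder : ℝ) ≠ 0 := by exact_mod_cast (torsionOrder_pos_holds (W := W)).ne'
  have ht' : (W'.torsionOrder : ℝ) ≠ 0 := by
    exact_mod_cast (torsionOrder_pos_holds (W := W')).ne'
  unfold bsdRHS
  rw [div_eq_div_iff (pow_ne_zero 2 ht') (pow_ne_zero 2 ht)]
  unfold shaOrder torsionOrder at *
  linear_combination key

end Rat

end WeierstrassCurve

end
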